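import Literature.NumberTheory.LFunctions.BurnolSonineEvaluators
import HarnessLib

/-!
# Burnol's evaluators, II: uniqueness of `Y^a_{w,k}`, the evaluators `Z^a_{w,k} ∈ K_a`, and
# The evaluators `Z^a_{w,k}` in the subspace `K_a`, "which are (for `w ≠ 0,1`) orthogonal projections
# from `L_a` to `K_a` of the evaluators `Y^a_{w,k}`" (Burnol 2004b, §2)

LINE 1 — LABEL: RH-FREE (Hilbert-space bookkeeping in the Sonine spaces `K_a ⊂ L_a ⊂ L²(0,∞)`: the
Fréchet–Riesz vectors of the continuous evaluations `f ↦ M(f)^{(k)}(w)` for Burnol's bilinear pairing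
`[f,g] = ∫₀^∞ fg`; no hypothesis and no conclusion about the location of any zero of `ζ`). FRAMING (cell
rh-crit, D-0074): corpus theorems are RH-FREE literature; nothing here is worded as progress toward RH.
bears_on: B-C/B-P (LADDER-RH COLUMN 6, de Branges framework). WHAT THIS IS NOT: not a route, not a
criterion, no positivity; the evaluators exist whatever the zeros of `ζ` are. Nothing here bears on the
truth of RH.

Source: J.-F. Burnol, *Two complete and minimal systems associated with the zeros of the Riemann zeta
function*, J. Théor. Nombres Bordeaux 16 (2004) 65–94 = arXiv:math/0203120v7 [Burnol2004b], §2,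
quoted VERBATIM from the TeX of record (`dbl/src/Burnol2004JTNB_arXivmath0203120v7.tex`):

> [Prop. 2.2, TeX l.460–468] "Let `f(t)` belong to `L_a`. Then its completed right Mellin transform
> `M(f)(s) = π^{-s/2}Γ(s/2)f̂(s)` is a meromorphic function in the entire complex plane, with at most
> poles at `0` and at `1`. The evaluations `f ↦ M(f)^{(k)}(w)` for `w ≠ 0`, `w ≠ 1`, or
> `f ↦ Res_{s=0}(M(f))`, `f ↦ Res_{s=1}(M(f))` are continuous linear forms on `L_a`."
>
> [TeX l.470–483] "We will write `Y^a_{w,k}` for the vector in `L_a` with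
> `∀ f ∈ L_a  ∫₀^∞ f(t)Y^a_{w,k}(t) dt = M(f)^{(k)}(w)`. This is for `w ≠ 0,1`. For `w = 0` we have
> `Y^a_0` which computes the residue at `0`, and similarly `Y^a_1` for the residue at `1`. We are using
> the bilinear forms `[f,g] = ∫₀^∞ f(t)g(t) dt` and not the Hermitian scalar product
> `(f,g) = ∫₀^∞ f(t)\overline{g(t)} dt` in order to ensure that the dependency of `Y^a_{w,k}` with
> respect to `w` is analytic and not anti-analytic. There are also evaluators `Z^a_{w,k}` in the
> subspace `K_a`, which are (for `w ≠ 0,1`) orthogonal projections from `L_a` to `K_a` of the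
> evaluators `Y^a_{w,k}`."
>
> [Thm. 2.1 (De Branges), TeX l.436–443] "Let `0 < a < ∞`. Let `f(t)` belong to `K_a`. Then its
> completed right Mellin transform `M(f)(s) = π^{-s/2}Γ(s/2)f̂(s)` is an entire function. The
> evaluations at complex numbers `w ∈ ℂ` are continuous linear forms on `K_a`."

The tree types these objects in `BurnolZetaSystems.lean` as the defining relations `IsBurnolY a w k Y`,
`IsBurnolZ a w k Z` and the Hilbert-`ε` choices `burnolY a w k`, `burnolZ a w k`; the companion module
`BurnolSonineEvaluators.lean` proves EXISTENCE for `Y` (`BurnolEvaluators.isBurnolY_burnolY`) together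
with the linearity of `burnolEval` on `L_a`. This theorem-only module adds (0 definitions, 0 named facts):

* `BurnolEvaluators.exists_pairing_repr` / `eq_of_pairing_eq` — a reusable Fréchet–Riesz ENGINE for
  the bilinear pairing `[f,g] = ∫₀^∞ fg` on any closed, conjugation-stable linear subspace of even
  classes (existence of the representing vector `Y = 2ȳ` of a bounded linear functional, and
  NON-DEGENERACY: `[D̄, D] = ½‖D‖²`), instantiated below at `K_a` and `L_a`;
* `IsBurnolY.unique`, `IsBurnolY.eq_burnolY` — UNIQUENESS of `Y^a_{w,k}` ("the vector"): the
  `ε`-chosen `burnolY` is canonical (no hypothesis on `a`, `w`, `k`);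
* `BurnolEvaluators.isBurnolZ_burnolZ`, `IsBurnolZ.unique`, `IsBurnolZ.eq_burnolZ`,
  `BurnolEvaluators.isBurnolZ_burnolZSystem` — EXISTENCE (for `0 < a`, `w ∉ {0, 1, −2, −4, …}`, every
  `k`: Prop. 2.2 (ii) restricted to `K_a ⊆ L_a` + Riesz in the closed `K_a`) and uniqueness of the
  evaluators `Z^a_{w,k} ∈ K_a`, and the instances at the indices `(ρ, k)` of the system `(Z^a_{ρ,k})`;
* `BurnolEvaluators.inner_burnolY_sub_burnolZ` (`Y^a_{w,k} − Z^a_{w,k} ⊥ K_a`),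
  `inner_burnolY_eq_inner_burnolZ`, `setIntegral_mul_burnolZ_eq_setIntegral_mul_burnolY` — the
  printed "orthogonal projections" relation between the two evaluators;
* plumbing: conjugation-stability of `K_a` (`mem_sonineK_of_conj`) and of `L_a` in the
  operator-free a.e. form (`mem_sonineL_of_conj`, from `BurnolEvaluators.conj_mem_sonineL`),
  `sub_mem_sonineL`/`sub_mem_sonineK`, `inner_eq_setIntegral_Ioi` (`⟪y,f⟫ = [f, 2ȳ]`).

## References
* [Burnol2004b] §2, TeX l.460–491 (Prop. 2.2, the evaluators `Y^a_{w,k}`, `Z^a_{w,k}`, the systems).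
* Mathlib: `InnerProductSpace.toDual` (Fréchet–Riesz), `MeasureTheory.L2.inner_def`.
* [Grafakos2014] Prop. 2.2.11 (5) (conjugation and `𝓕`; tree `L2FourierConj.lean`).
-/

noncomputable section

open MeasureTheory Complex Filter Set FourierTransform
open scoped ComplexConjugate Topology ENNReal
open Literature.Analysis.Fourier

namespace Literature.NumberTheory.LFunctions

namespace BurnolEvaluators

/-! ## A. Conjugation and the Sonine spaces (operator-free a.e. forms) -/

/-- Every `L²` class has a conjugate class (`𝖩u = conj ∘ u` a.e., tree `L2FourierConj`). [cite: Grafakos2014, Prop. 2.2.11 (5), PDF p. 126] -/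
theorem exists_conj (u : Lp ℂ 2 (volume : Measure ℝ)) :
    ∃ v : Lp ℂ 2 (volume : Measure ℝ), (v : ℝ → ℂ) =ᵐ[volume] fun x ↦ conj ((u : ℝ → ℂ) x) :=
  ⟨_, coeFn_conjLp u⟩

/-- A class a.e. equal to `conj ∘ u` IS the conjugate class `𝖩u`. [cite: Grafakos2014, Prop. 2.2.11 (5), PDF p. 126] -/
theorem eq_conjLp_of_ae_eq {u v : Lp ℂ 2 (volume : Measure ℝ)}
    (hv : (v : ℝ → ℂ) =ᵐ[volume] fun x ↦ conj ((u : ℝ → ℂ) x)) :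
    v = ((starₗᵢ ℂ : ℂ ≃ₗᵢ⋆[ℂ] ℂ).toContinuousLinearEquiv : ℂ →L⋆[ℂ] ℂ).compLpL 2
      (volume : Measure ℝ) u :=
  Lp.ext (hv.trans (coeFn_conjLp u).symm)

/-- The conjugate of an even class is even. [cite: Burnol2004b, §1 Note (arXiv:math/0203120v7 p. 3, TeX l.295–309)] -/
theorem mem_evenL2_of_conj {u v : Lp ℂ 2 (volume : Measure ℝ)} (hu : u ∈ evenL2)
    (hv : (v : ℝ → ℂ) =ᵐ[volume] fun x ↦ conj ((u : ℝ → ℂ) x)) : v ∈ evenL2 := by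
  have hneg : Measure.QuasiMeasurePreserving (fun x : ℝ ↦ -x) volume volume :=
    (Measure.measurePreserving_neg (volume : Measure ℝ)).quasiMeasurePreserving
  have hu' : ∀ᵐ x : ℝ, (u : ℝ → ℂ) (-x) = (u : ℝ → ℂ) x := hu
  show ∀ᵐ x : ℝ, (v : ℝ → ℂ) (-x) = (v : ℝ → ℂ) x
  filter_upwards [hv, hneg.ae hv, hu'] with x h1 h2 h3
  rw [h2, h1, h3]

/-- The Fourier transform of the conjugate of an EVEN class is the conjugate of its Fourier transform
(`𝓕(ū) = conj 𝓕⁻u` and `𝓕⁻u = 𝓕u` for even `u`). [cite: Grafakos2014, Prop. 2.2.11 (4),(5), PDF p. 126] -/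
theorem fourier_conj_of_mem_evenL2 {u v : Lp ℂ 2 (volume : Measure ℝ)} (hu : u ∈ evenL2)
    (hv : (v : ℝ → ℂ) =ᵐ[volume] fun x ↦ conj ((u : ℝ → ℂ) x)) :
    ((𝓕 v : Lp ℂ 2 (volume : Measure ℝ)) : ℝ → ℂ) =ᵐ[volume]
      fun x ↦ conj (((𝓕 u : Lp ℂ 2 (volume : Measure ℝ)) : ℝ → ℂ) x) := by
  have h := fourier_conj_ae_eq hv
  rw [fourierInv_eq_fourier_compNeg, compNeg_eq_self_of_mem_evenL2 hu] at h
  exact h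

/-- **`L_a` is stable under complex conjugation**, a.e. form (from `conj_mem_sonineL`). [cite: Burnol2004b, §2 (arXiv:math/0203120v7 p. 5, TeX l.413–423, 474–479)] -/
theorem mem_sonineL_of_conj {a : ℝ} {u v : Lp ℂ 2 (volume : Measure ℝ)} (hu : u ∈ sonineL a)
    (hv : (v : ℝ → ℂ) =ᵐ[volume] fun x ↦ conj ((u : ℝ → ℂ) x)) : v ∈ sonineL a := by
  rw [eq_conjLp_of_ae_eq hv]
  exact conj_mem_sonineL hu

/-- **`K_a` is stable under complex conjugation** (its three defining conditions are). [cite: Burnol2004b, §2 (arXiv:math/0203120v7 p. 5, TeX l.423–434)] -/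
theorem mem_sonineK_of_conj {a : ℝ} {u v : Lp ℂ 2 (volume : Measure ℝ)} (hu : u ∈ sonineK a)
    (hv : (v : ℝ → ℂ) =ᵐ[volume] fun x ↦ conj ((u : ℝ → ℂ) x)) : v ∈ sonineK a := by
  obtain ⟨he, hc, hc'⟩ := hu
  refine ⟨mem_evenL2_of_conj he hv, ?_, ?_⟩
  · filter_upwards [hv, hc] with x hx h hxa
    rw [hx, h hxa, map_zero]
  · filter_upwards [fourier_conj_of_mem_evenL2 he hv, hc'] with x hx h hxa
    rw [hx, h hxa, map_zero]

/-- `L_a` is stable under subtraction. [cite: Burnol2004b, §2 (arXiv:math/0203120v7 p. 5, TeX l.413–416)] -/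
theorem sub_mem_sonineL {a : ℝ} {f g : Lp ℂ 2 (volume : Measure ℝ)} (hf : f ∈ sonineL a)
    (hg : g ∈ sonineL a) : f - g ∈ sonineL a := by
  rw [sub_eq_add_neg, ← neg_one_smul ℂ g]
  exact add_mem_sonineL hf (smul_mem_sonineL _ hg)

/-- `K_a` is stable under subtraction. [cite: Burnol2004b, §2 (arXiv:math/0203120v7 p. 5, TeX l.423–434)] -/
theorem sub_mem_sonineK {a : ℝ} {f g : Lp ℂ 2 (volume : Measure ℝ)} (hf : f ∈ sonineK a)
    (hg : g ∈ sonineK a) : f - g ∈ sonineK a := by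
  rw [sub_eq_add_neg, ← neg_one_smul ℂ g]
  exact add_mem_sonineK hf (smul_mem_sonineK _ hg)

/-! ## B. The bilinear pairing `[f,g] = ∫₀^∞ fg` versus the Hermitian product on even classes -/

/-- **From the Hermitian product to Burnol's bilinear pairing**: for even classes `y, f` and `v = ȳ`,
`⟪y, f⟫ = ∫_ℝ ȳ f = 2∫₀^∞ f ȳ = [f, 2ȳ]` (via `setIntegral_mul_conj_eq_half_inner`).
[cite: Burnol2004b, §2 (arXiv:math/0203120v7 p. 5, TeX l.474–479: "We are using the bilinear forms `[f,g] = ∫₀^∞ f(t)g(t) dt`")] -/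
theorem inner_eq_setIntegral_Ioi {y f v : Lp ℂ 2 (volume : Measure ℝ)} (hy : y ∈ evenL2)
    (hf : f ∈ evenL2) (hv : (v : ℝ → ℂ) =ᵐ[volume] fun x ↦ conj ((y : ℝ → ℂ) x)) :
    inner ℂ y f = ∫ t in Ioi (0 : ℝ), f t * ((2 : ℂ) • v) t := by
  have h := setIntegral_mul_conj_eq_half_inner hf hy
  calc inner ℂ y f = 2 * ∫ t in Ioi (0 : ℝ), (f : ℝ → ℂ) t * conj ((y : ℝ → ℂ) t) := by
        rw [h]; ring
    _ = ∫ t in Ioi (0 : ℝ), 2 * ((f : ℝ → ℂ) t * conj ((y : ℝ → ℂ) t)) := (integral_const_mul _ _).symm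
    _ = ∫ t in Ioi (0 : ℝ), f t * ((2 : ℂ) • v) t := by
        refine integral_congr_ae ((ae_restrict_of_ae ((Lp.coeFn_smul (2 : ℂ) v).and hv)).mono
          fun t ht ↦ ?_)
        beta_reduce
        rw [ht.1, Pi.smul_apply, smul_eq_mul, ht.2]
        ring

/-! ## C. Fréchet–Riesz for the bilinear pairing on a closed, even, conjugation-stable subspace -/

/-- **Representation engine.** On a closed linear subspace `S ⊆ K` of even classes, stable under
conjugation, every bounded linear functional `ℓ` is `f ↦ [f, Y] = ∫₀^∞ f·Y` for some `Y ∈ S`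
(Fréchet–Riesz in the Hilbert space `S` gives `y` with `⟪y,f⟫ = ℓ(f)`; then `Y := 2ȳ ∈ S`).
[cite: Burnol2004b, §2 (arXiv:math/0203120v7 p. 5, TeX l.470–483)] -/
theorem exists_pairing_repr {S : Set (Lp ℂ 2 (volume : Measure ℝ))} (hS : IsClosed S)
    (h0 : (0 : Lp ℂ 2 (volume : Measure ℝ)) ∈ S)
    (hadd : ∀ f ∈ S, ∀ g ∈ S, f + g ∈ S) (hsmul : ∀ (c : ℂ), ∀ f ∈ S, c • f ∈ S)
    (heven : S ⊆ evenL2)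
    (hconj : ∀ u ∈ S, ∀ v : Lp ℂ 2 (volume : Measure ℝ),
      ((v : ℝ → ℂ) =ᵐ[volume] fun x ↦ conj ((u : ℝ → ℂ) x)) → v ∈ S)
    (ℓ : Lp ℂ 2 (volume : Measure ℝ) → ℂ) (hℓadd : ∀ f ∈ S, ∀ g ∈ S, ℓ (f + g) = ℓ f + ℓ g)
    (hℓsmul : ∀ (c : ℂ), ∀ f ∈ S, ℓ (c • f) = c * ℓ f)
    (hℓbd : ∃ C : ℝ, ∀ f ∈ S, ‖ℓ f‖ ≤ C * ‖f‖) :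
    ∃ Y ∈ S, ∀ f ∈ S, ∫ t in Ioi (0 : ℝ), f t * Y t = ℓ f := by
  let V : Submodule ℂ (Lp ℂ 2 (volume : Measure ℝ)) :=
    { carrier := S
      add_mem' := fun hf hg ↦ hadd _ hf _ hg
      zero_mem' := h0
      smul_mem' := fun c _ hf ↦ hsmul c _ hf }
  haveI : CompleteSpace V := hS.completeSpace_coe
  let φ : V →ₗ[ℂ] ℂ :=
    { toFun := fun v ↦ ℓ v
      map_add' := fun u v ↦ hℓadd _ u.2 _ v.2
      map_smul' := fun c v ↦ by
        rw [RingHom.id_apply, smul_eq_mul]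
        exact hℓsmul c _ v.2 }
  obtain ⟨C, hC⟩ := hℓbd
  let φL : V →L[ℂ] ℂ := φ.mkContinuousOfExistsBound ⟨C, fun v ↦ hC _ v.2⟩
  obtain ⟨v, hv⟩ := exists_conj (((InnerProductSpace.toDual ℂ V).symm φL : V) :
    Lp ℂ 2 (volume : Measure ℝ))
  have hyS : (((InnerProductSpace.toDual ℂ V).symm φL : V) : Lp ℂ 2 (volume : Measure ℝ)) ∈ S :=
    ((InnerProductSpace.toDual ℂ V).symm φL).2
  refine ⟨(2 : ℂ) • v, hsmul 2 v (hconj _ hyS v hv), fun f hf ↦ ?_⟩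
  rw [← inner_eq_setIntegral_Ioi (heven hyS) (heven hf) hv]
  have h := InnerProductSpace.toDual_symm_apply (𝕜 := ℂ) (E := V) (x := ⟨f, hf⟩) (y := φL)
  rw [Submodule.coe_inner] at h
  rw [h]
  simp [φL, φ]

/-- **Uniqueness engine**: on a linear subspace `S ⊆ K` of even classes stable under conjugation the
pairing `[·,·]` is non-degenerate (`[2D̄, D] = 2∫₀^∞ |D|² = ‖D‖²`), so two vectors of `S` with the
same pairings against all of `S` coincide. [cite: Burnol2004b, §2 (arXiv:math/0203120v7 p. 5, TeX l.470–479: "the vector in `L_a`")] -/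
theorem eq_of_pairing_eq {S : Set (Lp ℂ 2 (volume : Measure ℝ))}
    (hsub : ∀ f ∈ S, ∀ g ∈ S, f - g ∈ S) (hsmul : ∀ (c : ℂ), ∀ f ∈ S, c • f ∈ S)
    (heven : S ⊆ evenL2)
    (hconj : ∀ u ∈ S, ∀ v : Lp ℂ 2 (volume : Measure ℝ),
      ((v : ℝ → ℂ) =ᵐ[volume] fun x ↦ conj ((u : ℝ → ℂ) x)) → v ∈ S)
    {Y₁ Y₂ : Lp ℂ 2 (volume : Measure ℝ)} (h₁ : Y₁ ∈ S) (h₂ : Y₂ ∈ S)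
    (h : ∀ f ∈ S, ∫ t in Ioi (0 : ℝ), f t * Y₁ t = ∫ t in Ioi (0 : ℝ), f t * Y₂ t) :
    Y₁ = Y₂ := by
  set D : Lp ℂ 2 (volume : Measure ℝ) := Y₁ - Y₂ with hD
  have hDS : D ∈ S := hsub _ h₁ _ h₂
  have hD0 : ∀ f ∈ S, ∫ t in Ioi (0 : ℝ), f t * D t = 0 := fun f hf ↦ by
    have i1 : Integrable (fun t : ℝ ↦ (f : ℝ → ℂ) t * (Y₁ : ℝ → ℂ) t) :=
      (Lp.memLp f).integrable_mul (Lp.memLp Y₁)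
    have i2 : Integrable (fun t : ℝ ↦ (f : ℝ → ℂ) t * (Y₂ : ℝ → ℂ) t) :=
      (Lp.memLp f).integrable_mul (Lp.memLp Y₂)
    calc ∫ t in Ioi (0 : ℝ), f t * D t
        = ∫ t in Ioi (0 : ℝ), ((f : ℝ → ℂ) t * (Y₁ : ℝ → ℂ) t - (f : ℝ → ℂ) t * (Y₂ : ℝ → ℂ) t) :=
          integral_congr_ae ((ae_restrict_of_ae (Lp.coeFn_sub Y₁ Y₂)).mono fun t ht ↦ by
            beta_reduce
            rw [ht, Pi.sub_apply, mul_sub])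
      _ = (∫ t in Ioi (0 : ℝ), f t * Y₁ t) - ∫ t in Ioi (0 : ℝ), f t * Y₂ t :=
          integral_sub i1.integrableOn i2.integrableOn
      _ = 0 := by rw [h f hf, sub_self]
  obtain ⟨v, hv⟩ := exists_conj D
  have hvS : (2 : ℂ) • v ∈ S := hsmul 2 v (hconj _ hDS v hv)
  have key : inner ℂ D D = 0 := by
    rw [inner_eq_setIntegral_Ioi (heven hDS) (heven hDS) hv, ← hD0 _ hvS]
    exact integral_congr_ae (Eventually.of_forall fun t ↦ mul_comm _ _)
  exact sub_eq_zero.1 (inner_self_eq_zero.1 key)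

end BurnolEvaluators

open BurnolEvaluators

/-! ## D. Uniqueness of `Y^a_{w,k}`: the `ε`-chosen `burnolY` is canonical -/

/-- RH-FREE. **UNIQUENESS of Burnol's evaluator `Y^a_{w,k}`** ("the vector in `L_a` with
`∀ f ∈ L_a ∫₀^∞ f(t)Y^a_{w,k}(t) dt = M(f)^{(k)}(w)`", TeX l.470–472 — the definite article): two
vectors of `L_a` with the defining property are equal
(non-degeneracy of `[f,g] = ∫₀^∞ fg` on the conjugation-stable space `L_a`; no hypothesis on `a`, `w`,
`k`). Existence is `BurnolEvaluators.isBurnolY_burnolY`. [cite: Burnol2004b, §2 (arXiv:math/0203120v7 p. 5, TeX l.470–479)] -/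
theorem IsBurnolY.unique {a : ℝ} {w : ℂ} {k : ℕ} {Y₁ Y₂ : Lp ℂ 2 (volume : Measure ℝ)}
    (h₁ : IsBurnolY a w k Y₁) (h₂ : IsBurnolY a w k Y₂) : Y₁ = Y₂ :=
  eq_of_pairing_eq (S := sonineL a) (fun _ hf _ hg ↦ sub_mem_sonineL hf hg)
    (fun c _ hf ↦ smul_mem_sonineL c hf) (fun _ hf ↦ hf.1)
    (fun _ hu _ hv ↦ mem_sonineL_of_conj hu hv) h₁.1 h₂.1
    (fun f hf ↦ by rw [h₁.2 f hf, h₂.2 f hf])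

/-- RH-FREE. If SOME vector has the defining property of `Y^a_{w,k}`, so does the `ε`-chosen `burnolY`
(no hypothesis on `w`; cf. `BurnolEvaluators.isBurnolY_burnolY` for the existence range).
[cite: Burnol2004b, §2 (arXiv:math/0203120v7 p. 5, TeX l.470–479)] -/
theorem IsBurnolY.isBurnolY_burnolY {a : ℝ} {w : ℂ} {k : ℕ} {Y : Lp ℂ 2 (volume : Measure ℝ)}
    (h : IsBurnolY a w k Y) : IsBurnolY a w k (burnolY a w k) :=
  Classical.epsilon_spec (p := fun Y ↦ IsBurnolY a w k Y) ⟨Y, h⟩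

/-- RH-FREE. **`burnolY` is canonical**: any vector with the defining property IS `burnolY a w k`.
[cite: Burnol2004b, §2 (arXiv:math/0203120v7 p. 5, TeX l.470–479)] -/
theorem IsBurnolY.eq_burnolY {a : ℝ} {w : ℂ} {k : ℕ} {Y : Lp ℂ 2 (volume : Measure ℝ)}
    (h : IsBurnolY a w k Y) : Y = burnolY a w k :=
  h.unique h.isBurnolY_burnolY

namespace BurnolEvaluators

/-! ## E. The evaluators `Z^a_{w,k} ∈ K_a` -/

/-- RH-FREE. **EXISTENCE of the evaluator `Z^a_{w,k} ∈ K_a`** ("There are also evaluators `Z^a_{w,k}`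
in the subspace `K_a`", TeX l.479–480; the vector of `K_a` with `[f, Z] = M(f)^{(k)}(w)` for all
`f ∈ K_a` — continuity of the evaluations on `K_a` is Thm. 2.1 [De Branges], TeX l.436–443, here
obtained by restriction from `L_a`, Prop. 2.2): for `0 < a`,
`w ∉ {0, 1, −2, −4, …}` and every `k`, the `ε`-chosen `burnolZ a w k` has its defining property.
Proof: Prop. 2.2 (ii) (`exists_bound_burnolEval_of_sonineL`) and the linearity of `burnolEval`
restricted to `K_a ⊆ L_a`, Fréchet–Riesz in the closed (`isClosed_sonineK`) conjugation-stable
(`mem_sonineK_of_conj`) space `K_a` via `exists_pairing_repr`.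
[cite: Burnol2004b, §2 (arXiv:math/0203120v7 p. 5, TeX l.479–483)] -/
theorem isBurnolZ_burnolZ {a : ℝ} (ha : 0 < a) {w : ℂ} (hw0 : w ≠ 0) (hw1 : w ≠ 1)
    (hwn : ∀ n : ℕ, w ≠ -2 * ((n : ℂ) + 1)) (k : ℕ) : IsBurnolZ a w k (burnolZ a w k) := by
  obtain ⟨C, hC⟩ := SonineLContinuation.exists_bound_burnolEval_of_sonineL ha hw0 hw1 hwn k
  obtain ⟨Z, hZS, hZ⟩ := exists_pairing_repr (isClosed_sonineK a) (zero_mem_sonineK a)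
    (fun _ hf _ hg ↦ add_mem_sonineK hf hg) (fun c _ hf ↦ smul_mem_sonineK c hf)
    (fun _ hf ↦ hf.1) (fun _ hu _ hv ↦ mem_sonineK_of_conj hu hv)
    (fun f ↦ burnolEval f w k)
    (fun _ hf _ hg ↦ burnolEval_add ha (sonineK_subset_sonineL a hf) (sonineK_subset_sonineL a hg)
      hw0 hw1 hwn k)
    (fun c _ hf ↦ burnolEval_smul ha c (sonineK_subset_sonineL a hf) hw0 hw1 hwn k)
    ⟨C, fun f hf ↦ hC f (sonineK_subset_sonineL a hf)⟩
  exact Classical.epsilon_spec (p := fun Z ↦ IsBurnolZ a w k Z) ⟨Z, hZS, hZ⟩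

end BurnolEvaluators

/-- RH-FREE. **UNIQUENESS of `Z^a_{w,k}`** (non-degeneracy of `[·,·]` on the conjugation-stable `K_a`;
no hypothesis on `a`, `w`, `k`). [cite: Burnol2004b, §2 (arXiv:math/0203120v7 p. 5, TeX l.479–483)] -/
theorem IsBurnolZ.unique {a : ℝ} {w : ℂ} {k : ℕ} {Z₁ Z₂ : Lp ℂ 2 (volume : Measure ℝ)}
    (h₁ : IsBurnolZ a w k Z₁) (h₂ : IsBurnolZ a w k Z₂) : Z₁ = Z₂ :=
  eq_of_pairing_eq (S := sonineK a) (fun _ hf _ hg ↦ sub_mem_sonineK hf hg)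
    (fun c _ hf ↦ smul_mem_sonineK c hf) (fun _ hf ↦ hf.1)
    (fun _ hu _ hv ↦ mem_sonineK_of_conj hu hv) h₁.1 h₂.1
    (fun f hf ↦ by rw [h₁.2 f hf, h₂.2 f hf])

/-- RH-FREE. If some vector has the defining property of `Z^a_{w,k}`, so does `burnolZ a w k`.
[cite: Burnol2004b, §2 (arXiv:math/0203120v7 p. 5, TeX l.479–483)] -/
theorem IsBurnolZ.isBurnolZ_burnolZ {a : ℝ} {w : ℂ} {k : ℕ} {Z : Lp ℂ 2 (volume : Measure ℝ)}
    (h : IsBurnolZ a w k Z) : IsBurnolZ a w k (burnolZ a w k) :=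
  Classical.epsilon_spec (p := fun Z ↦ IsBurnolZ a w k Z) ⟨Z, h⟩

/-- RH-FREE. **`burnolZ` is canonical.** [cite: Burnol2004b, §2 (arXiv:math/0203120v7 p. 5, TeX l.479–483)] -/
theorem IsBurnolZ.eq_burnolZ {a : ℝ} {w : ℂ} {k : ℕ} {Z : Lp ℂ 2 (volume : Measure ℝ)}
    (h : IsBurnolZ a w k Z) : Z = burnolZ a w k :=
  h.unique h.isBurnolZ_burnolZ

namespace BurnolEvaluators

/-- RH-FREE. `Z^a_{w,k} ∈ K_a`. [cite: Burnol2004b, §2 (arXiv:math/0203120v7 p. 5, TeX l.479–483)] -/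
theorem burnolZ_mem_sonineK {a : ℝ} (ha : 0 < a) {w : ℂ} (hw0 : w ≠ 0) (hw1 : w ≠ 1)
    (hwn : ∀ n : ℕ, w ≠ -2 * ((n : ℂ) + 1)) (k : ℕ) : burnolZ a w k ∈ sonineK a :=
  (isBurnolZ_burnolZ ha hw0 hw1 hwn k).1

/-- RH-FREE. The reproducing identity `[f, Z^a_{w,k}] = ∫₀^∞ f·Z^a_{w,k} = M(f)^{(k)}(w)` on `K_a`.
[cite: Burnol2004b, §2 (arXiv:math/0203120v7 p. 5, TeX l.479–483)] -/
theorem setIntegral_mul_burnolZ {a : ℝ} (ha : 0 < a) {w : ℂ} (hw0 : w ≠ 0) (hw1 : w ≠ 1)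
    (hwn : ∀ n : ℕ, w ≠ -2 * ((n : ℂ) + 1)) (k : ℕ) {f : Lp ℂ 2 (volume : Measure ℝ)}
    (hf : f ∈ sonineK a) :
    ∫ t in Ioi (0 : ℝ), f t * burnolZ a w k t = burnolEval f w k :=
  (isBurnolZ_burnolZ ha hw0 hw1 hwn k).2 f hf

/-! ## F. The `Z^a_{w,k}` "are (for `w ≠ 0,1`) orthogonal projections from `L_a` to `K_a` of the evaluators `Y^a_{w,k}`" -/

/-- RH-FREE. **"evaluators `Z^a_{w,k}` in the subspace `K_a`, which are (for `w ≠ 0,1`) orthogonal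
projections from `L_a` to `K_a` of the evaluators `Y^a_{w,k}`"** (TeX l.479–483):
`Y^a_{w,k} − Z^a_{w,k} ⊥ K_a` (with `Z^a_{w,k} ∈ K_a`,
`burnolZ_mem_sonineK`). For `g ∈ K_a`: `⟪g, Y − Z⟫ = [2ḡ, Y] − [2ḡ, Z] = M(2ḡ)^{(k)}(w) − M(2ḡ)^{(k)}(w)
= 0`, since `2ḡ ∈ K_a ⊆ L_a`. [cite: Burnol2004b, §2 (arXiv:math/0203120v7 p. 5, TeX l.479–483)] -/
theorem inner_burnolY_sub_burnolZ {a : ℝ} (ha : 0 < a) {w : ℂ} (hw0 : w ≠ 0) (hw1 : w ≠ 1)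
    (hwn : ∀ n : ℕ, w ≠ -2 * ((n : ℂ) + 1)) (k : ℕ) {g : Lp ℂ 2 (volume : Measure ℝ)}
    (hg : g ∈ sonineK a) :
    inner ℂ g (burnolY a w k - burnolZ a w k) = 0 := by
  have hY := isBurnolY_burnolY ha hw0 hw1 hwn k
  have hZ := isBurnolZ_burnolZ ha hw0 hw1 hwn k
  obtain ⟨v, hv⟩ := exists_conj g
  have hvK : (2 : ℂ) • v ∈ sonineK a := smul_mem_sonineK 2 (mem_sonineK_of_conj hg hv)
  have e1 : inner ℂ g (burnolY a w k) = burnolEval ((2 : ℂ) • v) w k := by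
    rw [inner_eq_setIntegral_Ioi hg.1 hY.1.1 hv, ← hY.2 _ (sonineK_subset_sonineL a hvK)]
    exact integral_congr_ae (Eventually.of_forall fun t ↦ mul_comm _ _)
  have e2 : inner ℂ g (burnolZ a w k) = burnolEval ((2 : ℂ) • v) w k := by
    rw [inner_eq_setIntegral_Ioi hg.1 hZ.1.1 hv, ← hZ.2 _ hvK]
    exact integral_congr_ae (Eventually.of_forall fun t ↦ mul_comm _ _)
  rw [inner_sub_right, e1, e2, sub_self]

/-- RH-FREE. Equivalently: `⟪g, Y^a_{w,k}⟫ = ⟪g, Z^a_{w,k}⟫` for every `g ∈ K_a`.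
[cite: Burnol2004b, §2 (arXiv:math/0203120v7 p. 5, TeX l.479–483)] -/
theorem inner_burnolY_eq_inner_burnolZ {a : ℝ} (ha : 0 < a) {w : ℂ} (hw0 : w ≠ 0) (hw1 : w ≠ 1)
    (hwn : ∀ n : ℕ, w ≠ -2 * ((n : ℂ) + 1)) (k : ℕ) {g : Lp ℂ 2 (volume : Measure ℝ)}
    (hg : g ∈ sonineK a) :
    inner ℂ g (burnolY a w k) = inner ℂ g (burnolZ a w k) := by
  have h := inner_burnolY_sub_burnolZ ha hw0 hw1 hwn k hg
  rwa [inner_sub_right, sub_eq_zero] at h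

/-- RH-FREE. The bilinear form of the projection relation: `[f, Z^a_{w,k}] = [f, Y^a_{w,k}]` for
`f ∈ K_a` (both equal `M(f)^{(k)}(w)`). [cite: Burnol2004b, §2 (arXiv:math/0203120v7 p. 5, TeX l.479–483)] -/
theorem setIntegral_mul_burnolZ_eq_setIntegral_mul_burnolY {a : ℝ} (ha : 0 < a) {w : ℂ}
    (hw0 : w ≠ 0) (hw1 : w ≠ 1) (hwn : ∀ n : ℕ, w ≠ -2 * ((n : ℂ) + 1)) (k : ℕ)
    {f : Lp ℂ 2 (volume : Measure ℝ)} (hf : f ∈ sonineK a) :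
    ∫ t in Ioi (0 : ℝ), f t * burnolZ a w k t = ∫ t in Ioi (0 : ℝ), f t * burnolY a w k t := by
  rw [setIntegral_mul_burnolZ ha hw0 hw1 hwn k hf,
    (isBurnolY_burnolY ha hw0 hw1 hwn k).2 f (sonineK_subset_sonineL a hf)]

/-- RH-FREE. **`Z^a_{w,k}` is CHARACTERISED as the orthogonal projection of `Y^a_{w,k}` onto `K_a`**:
the unique `Z ∈ K_a` with `Y^a_{w,k} − Z ⊥ K_a` is `burnolZ a w k` (so the printed description and the
tree's defining relation `IsBurnolZ` single out the same vector).
[cite: Burnol2004b, §2 (arXiv:math/0203120v7 p. 5, TeX l.479–483)] -/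
theorem eq_burnolZ_of_inner_sub_eq_zero {a : ℝ} (ha : 0 < a) {w : ℂ} (hw0 : w ≠ 0) (hw1 : w ≠ 1)
    (hwn : ∀ n : ℕ, w ≠ -2 * ((n : ℂ) + 1)) (k : ℕ) {Z : Lp ℂ 2 (volume : Measure ℝ)}
    (hZK : Z ∈ sonineK a) (hperp : ∀ g ∈ sonineK a, inner ℂ g (burnolY a w k - Z) = 0) :
    Z = burnolZ a w k := by
  have hZ0 := isBurnolZ_burnolZ ha hw0 hw1 hwn k
  -- `Z − burnolZ ∈ K_a` is orthogonal to `K_a`, hence zero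
  have hD : Z - burnolZ a w k ∈ sonineK a := sub_mem_sonineK hZK hZ0.1
  have hperp' : inner ℂ (Z - burnolZ a w k) (Z - burnolZ a w k) = 0 := by
    have h1 := hperp _ hD
    have h2 := inner_burnolY_sub_burnolZ ha hw0 hw1 hwn k hD
    have e : Z - burnolZ a w k = (burnolY a w k - burnolZ a w k) - (burnolY a w k - Z) := by abel
    have h3 : inner ℂ (Z - burnolZ a w k)
        ((burnolY a w k - burnolZ a w k) - (burnolY a w k - Z)) = 0 := by
      rw [inner_sub_right, h1, h2, sub_self]
    rwa [← e] at h3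
  exact sub_eq_zero.1 (inner_self_eq_zero.1 hperp')

/-! ## G. The system `(Z^a_{ρ,k})` indexed by the non-trivial zeros -/

/-- RH-FREE. **Every vector of the system `(Z^a_{ρ,k})`, `0 ≤ k < m_ρ`, is a genuine evaluator in
`K_a`** (a non-trivial zero is never `0`, `1` or a trivial zero: `admissible_of_mem_nontrivialZeros`).
[cite: Burnol2004b, Thm. 3.2 (arXiv:math/0203120v7 p. 6, TeX l.528–539)] -/
theorem isBurnolZ_burnolZSystem {a : ℝ} (ha : 0 < a) (p : ZetaZeroIndex) :
    IsBurnolZ a p.1.1 p.1.2 (burnolZSystem a p) := by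
  obtain ⟨h0, h1, hn⟩ := admissible_of_mem_nontrivialZeros p.2.1
  exact isBurnolZ_burnolZ ha h0 h1 hn p.1.2

/-- RH-FREE. The vectors of the system `(Z^a_{ρ,k})` lie in `K_a`. [cite: Burnol2004b, Thm. 3.2 (arXiv:math/0203120v7 p. 6, TeX l.528–539)] -/
theorem burnolZSystem_mem_sonineK {a : ℝ} (ha : 0 < a) (p : ZetaZeroIndex) :
    burnolZSystem a p ∈ sonineK a :=
  (isBurnolZ_burnolZSystem ha p).1

/-- RH-FREE. For each index the two systems are related by the projection: `Y^a_{ρ,k} − Z^a_{ρ,k} ⊥ K_a`.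
[cite: Burnol2004b, §2 (arXiv:math/0203120v7 p. 5, TeX l.479–491)] -/
theorem inner_burnolYSystem_sub_burnolZSystem {a : ℝ} (ha : 0 < a) (p : ZetaZeroIndex)
    {g : Lp ℂ 2 (volume : Measure ℝ)} (hg : g ∈ sonineK a) :
    inner ℂ g (burnolYSystem a p - burnolZSystem a p) = 0 := by
  obtain ⟨h0, h1, hn⟩ := admissible_of_mem_nontrivialZeros p.2.1
  exact inner_burnolY_sub_burnolZ ha h0 h1 hn p.1.2 hg

end BurnolEvaluators

end Literature.NumberTheory.LFunctions
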